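import Mathlib
import Summits.CriticalPhenomena.PercolationContinuityZ3.Theorems.PercNearOneGluingNoHeavyLowerTailOrientedAntipodalHallChain

/-!
# Cyclic selections of antipodal bads: reduction of capacity-one Hall to the three-family inequality `MS3-cyc`

Helper file for crux `stmt-CriticalPhenomena-4575` (`NoHeavyLowerTail`, route `PercNearOneGluingNoHeavy`),
new-inequality factory seat `prim-ineq-gen-3` (gen 5).  Everything here is PROVED; the open combinatorial inequality
enters as a HYPOTHESIS (`hMS3`), exactly as `MS2′` entered gen 3's `card_add_card_le_card_goods_above_chain` (since
discharged, `card_add_card_le_card_goods_above_chain'`).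

A *cyclic* orientation selection consists of the ordered bad types `(i,j), (j,l), (l,i)` (`i,j,l` distinct) of a
sunflower labeling `f`; write `D₁, D₂, D₃` for families of bads of these types inside `S`.  Explicit goods above them:
`X' ∪ (S \ X)` for `X, X'` of the same type; `X ∪ Y` for `X ∈ D_t`, `Y ∈ D_{t+1}` (consecutive types: the label of
`X ∪ Y` lies above two different petals, that of its complement below two different petals); and — the new, 'witnessed'
goods found by this seat (memo §3c(xviii)) — `X ∪ (S \ Y)` for `X ∈ D_t`, `Y ∈ D_{t+1}` whenever `Y \ X ⊆ Z` for some
`Z ∈ D_{t+2}`: its label is `≥ C_first(X) ∨ C_second(Y)`, two different petals, and its complement `Y \ X` lies below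
`Y`, `S \ X` (both petal `second(X) = first(Y)`) AND below `Z` (petal `first(Z) ≠ first(Y)`), hence is `B`.  These goods
are the complements in `S` of the members of
`K = ⋃_t (D_t \\ D_t) ∪ ⋃_t {S \ (X ∪ Y)} ∪ ⋃_t {Y \ X : Y \ X ⊆ Z for some Z ∈ D_{t+2}}`,
so the capacity-one Hall count for the cyclic selection follows from `#D₁ + #D₂ + #D₃ ≤ #K` — CONJECTURE `MS3-cyc`
(for pairwise disjoint families with `X ∪ Y ≠ S` across families; verified exhaustively on ground sets of size ≤ 4,
3.0 M triples, and for all triples with at most 6 members on 5 points, 129 M; open).  With the complementary selection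
(also cyclic) this is the localized antipodal inequality `LOC-P₂`.
(prim-ineq-gen-3 gen 5, 2026-08-20; memo `run/shared/lean/prim/prim-ineq-gen-3/COMB.md` §3c (xviii).)
-/

namespace Summit.CriticalPhenomena.PercolationContinuityZ3.Theorems

namespace OrientedAntipodalHall

open Finset AntipodalStrongHarris AntipodalStrongHarris.Lab
open scoped FinsetFamily

variable {α : Type*} [DecidableEq α] {k : ℕ}

/-- The union `X ∪ Y` of two bads of consecutive cyclic types `(a,b)`, `(b,c)` (`a ≠ b`, `b ≠ c`... only `a ≠ b` and
`b ≠ c` are used: label above `C_a, C_b`, complement below `C_b, C_c`) is a good set containing `X`. -/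
theorem good_union_of_consecutive (S : Finset α) {f : Finset α → Lab k}
    (hf : ∀ ⦃X Y : Finset α⦄, X ⊆ Y → f X ≤ f Y) {X Y : Finset α} (hXS : X ⊆ S) (hYS : Y ⊆ S)
    {a b c : Fin k} (hab : a ≠ b) (hbc : b ≠ c) (hX : f X = petal a) (hSX : f (S \ X) = petal b)
    (hY : f Y = petal b) (hSY : f (S \ Y) = petal c) :
    f (S \ (S \ (X ∪ Y))) = top ∧ f (S \ (S \ (S \ (X ∪ Y)))) = bot ∧ X ⊆ S \ (S \ (X ∪ Y)) := by
  have hXYS : X ∪ Y ⊆ S := union_subset hXS hYS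
  rw [Finset.sdiff_sdiff_eq_self hXYS]
  refine ⟨?_, ?_, subset_union_left⟩
  · refine eq_top_of_petal_le hab ?_ ?_
    · rw [← hX]; exact hf subset_union_left
    · rw [← hY]; exact hf subset_union_right
  · refine eq_bot_of_le_petal hbc ?_ ?_
    · rw [← hSX]; exact hf (sdiff_subset_sdiff le_rfl subset_union_left)
    · rw [← hSY]; exact hf (sdiff_subset_sdiff le_rfl subset_union_right)

/-- The witnessed good: for bads `X` of type `(a,b)`, `Y` of type `(b,c)` and `Z` with `f Z = C_c`, `c ≠ b`, `a ≠ c`,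
if `Y \ X ⊆ Z` then `X ∪ (S \ Y) = S \ (Y \ X)` is a good set containing `X`. -/
theorem good_witnessed (S : Finset α) {f : Finset α → Lab k}
    (hf : ∀ ⦃X Y : Finset α⦄, X ⊆ Y → f X ≤ f Y) {X Y Z : Finset α} (hXS : X ⊆ S) (hYS : Y ⊆ S)
    {a b c : Fin k} (hac : a ≠ c) (hbc : b ≠ c) (hX : f X = petal a)
    (hY : f Y = petal b) (hSY : f (S \ Y) = petal c) (hZ : f Z = petal c) (hw : Y \ X ⊆ Z) :
    f (S \ (Y \ X)) = top ∧ f (S \ (S \ (Y \ X))) = bot ∧ X ⊆ S \ (Y \ X) := by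
  have hsub : X ⊆ S \ (Y \ X) := by
    intro x hx
    exact mem_sdiff.mpr ⟨hXS hx, fun h => (mem_sdiff.mp h).2 hx⟩
  refine ⟨?_, ?_, hsub⟩
  · refine eq_top_of_petal_le hac ?_ ?_
    · rw [← hX]; exact hf hsub
    · rw [← hSY]; exact hf (sdiff_subset_sdiff le_rfl sdiff_subset)
  · rw [Finset.sdiff_sdiff_eq_self (sdiff_subset.trans hYS)]
    refine eq_bot_of_le_petal hbc ?_ ?_
    · rw [← hY]; exact hf sdiff_subset
    · rw [← hZ]; exact hf hw

/-- Members of a cyclic block `(P \\ P) ∪ {S \ (X ∪ Y)} ∪ {Y \ X : Y \ X ⊆ Z, Z ∈ R}` (`X ∈ P`, `Y ∈ Q`) are complements (in `S`)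
of good sets above a member of `P`, for bads of consecutive cyclic types `(a,b)` (family `P`), `(b,c)` (family `Q`) and
witnesses of set-label `C_c` (family `R`). -/
theorem compl_good_of_mem_cyclicBlock (S : Finset α) {f : Finset α → Lab k}
    (hf : ∀ ⦃X Y : Finset α⦄, X ⊆ Y → f X ≤ f Y) (P Q R : Finset (Finset α)) {a b c : Fin k}
    (hab : a ≠ b) (hbc : b ≠ c) (hac : a ≠ c)
    (hPS : ∀ X ∈ P, X ⊆ S) (hPa : ∀ X ∈ P, f X = petal a) (hPb : ∀ X ∈ P, f (S \ X) = petal b)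
    (hQS : ∀ Y ∈ Q, Y ⊆ S) (hQb : ∀ Y ∈ Q, f Y = petal b) (hQc : ∀ Y ∈ Q, f (S \ Y) = petal c)
    (hRc : ∀ Z ∈ R, f Z = petal c) {T : Finset α}
    (hT : T ∈ ((P \\ P) ∪ ((P ×ˢ Q).image fun p => S \ (p.1 ∪ p.2)) ∪
        (((P ×ˢ Q).filter fun p => ∃ Z ∈ R, p.2 \ p.1 ⊆ Z).image fun p => p.2 \ p.1))) :
    T ⊆ S ∧ f (S \ T) = top ∧ f (S \ (S \ T)) = bot ∧ ∃ X ∈ P, X ⊆ S \ T := by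
  rw [mem_union, mem_union] at hT
  rcases hT with (hT | hT) | hT
  · -- T = X \ X' : complement X' ∪ (S \ X), good above X'
    obtain ⟨X, hX, X', hX', rfl⟩ := mem_diffs.mp hT
    obtain ⟨h1, h2, h3⟩ := good_compl_diff S hf (hPS X hX) (hPS X' hX') hab hab (hPa X' hX') (hPb X hX)
      (hPa X hX) (hPb X' hX')
    exact ⟨sdiff_subset.trans (hPS X hX), h1, h2, X', hX', h3⟩
  · -- T = S \ (X ∪ Y)
    obtain ⟨p, hp, rfl⟩ := mem_image.mp hT
    obtain ⟨hX, hY⟩ := mem_product.mp hp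
    obtain ⟨h1, h2, h3⟩ := good_union_of_consecutive S hf (hPS _ hX) (hQS _ hY) hab hbc (hPa _ hX) (hPb _ hX)
      (hQb _ hY) (hQc _ hY)
    exact ⟨sdiff_subset, h1, h2, p.1, hX, h3⟩
  · -- T = Y \ X witnessed by Z
    obtain ⟨p, hp, rfl⟩ := mem_image.mp hT
    obtain ⟨hp', hw⟩ := mem_filter.mp hp
    obtain ⟨hX, hY⟩ := mem_product.mp hp'
    obtain ⟨Z, hZ, hZw⟩ := hw
    obtain ⟨h1, h2, h3⟩ := good_witnessed S hf (hPS _ hX) (hQS _ hY) hac hbc (hPa _ hX) (hQb _ hY) (hQc _ hY)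
      (hRc Z hZ) hZw
    exact ⟨sdiff_subset.trans (hQS _ hY), h1, h2, p.1, hX, h3⟩

/-- **Cyclic selections: Hall count modulo the three-family inequality `MS3-cyc`.**  Let `f` be a sunflower labeling and
`D₁, D₂, D₃` families of antipodal bads inside `S` of types `(i,j)`, `(j,l)`, `(l,i)` with `i, j, l` distinct — a cyclic
orientation selection.  If `#D₁ + #D₂ + #D₃ ≤ #(K₁ ∪ K₂ ∪ K₃)` with `K_t = (D_t \\ D_t) ∪ {S \ (X ∪ Y)} ∪ {Y \ X : Y \ X ⊆ Z ∈ D_{t+2}}` over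
`X ∈ D_t, Y ∈ D_{t+1}` (the instance of conjecture `MS3-cyc`), then at least `#D₁ + #D₂ + #D₃` good sets `U ⊆ S` contain a member of
`D₁ ∪ D₂ ∪ D₃` (capacity-one Hall for the cyclic selection). -/
theorem card_le_card_goods_above_cyclic (S : Finset α) {f : Finset α → Lab k}
    (hf : ∀ ⦃X Y : Finset α⦄, X ⊆ Y → f X ≤ f Y) (D₁ D₂ D₃ : Finset (Finset α)) {i j l : Fin k}
    (hij : i ≠ j) (hjl : j ≠ l) (hil : i ≠ l)
    (h₁S : ∀ X ∈ D₁, X ⊆ S) (h₁i : ∀ X ∈ D₁, f X = petal i) (h₁j : ∀ X ∈ D₁, f (S \ X) = petal j)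
    (h₂S : ∀ X ∈ D₂, X ⊆ S) (h₂j : ∀ X ∈ D₂, f X = petal j) (h₂l : ∀ X ∈ D₂, f (S \ X) = petal l)
    (h₃S : ∀ X ∈ D₃, X ⊆ S) (h₃l : ∀ X ∈ D₃, f X = petal l) (h₃i : ∀ X ∈ D₃, f (S \ X) = petal i)
    (hMS3 : #D₁ + #D₂ + #D₃ ≤
      #(((D₁ \\ D₁) ∪ ((D₁ ×ˢ D₂).image fun p => S \ (p.1 ∪ p.2)) ∪
        (((D₁ ×ˢ D₂).filter fun p => ∃ Z ∈ D₃, p.2 \ p.1 ⊆ Z).image fun p => p.2 \ p.1)) ∪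
        ((D₂ \\ D₂) ∪ ((D₂ ×ˢ D₃).image fun p => S \ (p.1 ∪ p.2)) ∪
        (((D₂ ×ˢ D₃).filter fun p => ∃ Z ∈ D₁, p.2 \ p.1 ⊆ Z).image fun p => p.2 \ p.1)) ∪
        ((D₃ \\ D₃) ∪ ((D₃ ×ˢ D₁).image fun p => S \ (p.1 ∪ p.2)) ∪
        (((D₃ ×ˢ D₁).filter fun p => ∃ Z ∈ D₂, p.2 \ p.1 ⊆ Z).image fun p => p.2 \ p.1)))) :
    #D₁ + #D₂ + #D₃ ≤
      #{U ∈ S.powerset | f U = top ∧ f (S \ U) = bot ∧ ∃ X ∈ D₁ ∪ D₂ ∪ D₃, X ⊆ U} := by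
  set E : Finset (Finset α) :=
    ((D₁ \\ D₁) ∪ ((D₁ ×ˢ D₂).image fun p => S \ (p.1 ∪ p.2)) ∪
        (((D₁ ×ˢ D₂).filter fun p => ∃ Z ∈ D₃, p.2 \ p.1 ⊆ Z).image fun p => p.2 \ p.1)) ∪
        ((D₂ \\ D₂) ∪ ((D₂ ×ˢ D₃).image fun p => S \ (p.1 ∪ p.2)) ∪
        (((D₂ ×ˢ D₃).filter fun p => ∃ Z ∈ D₁, p.2 \ p.1 ⊆ Z).image fun p => p.2 \ p.1)) ∪
        ((D₃ \\ D₃) ∪ ((D₃ ×ˢ D₁).image fun p => S \ (p.1 ∪ p.2)) ∪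
        (((D₃ ×ˢ D₁).filter fun p => ∃ Z ∈ D₂, p.2 \ p.1 ⊆ Z).image fun p => p.2 \ p.1)) with hE
  -- every member of `E` is a subset of `S` whose complement is a good set above a member of `D₁ ∪ D₂ ∪ D₃`
  have hmem : ∀ T ∈ E, T ⊆ S ∧ f (S \ T) = top ∧ f (S \ (S \ T)) = bot ∧ ∃ X ∈ D₁ ∪ D₂ ∪ D₃, X ⊆ S \ T := by
    intro T hT
    rw [hE, mem_union, mem_union] at hT
    rcases hT with (hT | hT) | hT
    · obtain ⟨h0, h1, h2, X, hX, h3⟩ := compl_good_of_mem_cyclicBlock S hf D₁ D₂ D₃ hij hjl hil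
        h₁S h₁i h₁j h₂S h₂j h₂l h₃l hT
      exact ⟨h0, h1, h2, X, mem_union_left _ (mem_union_left _ hX), h3⟩
    · obtain ⟨h0, h1, h2, X, hX, h3⟩ := compl_good_of_mem_cyclicBlock S hf D₂ D₃ D₁ hjl hil.symm hij.symm
        h₂S h₂j h₂l h₃S h₃l h₃i h₁i hT
      exact ⟨h0, h1, h2, X, mem_union_left _ (mem_union_right _ hX), h3⟩
    · obtain ⟨h0, h1, h2, X, hX, h3⟩ := compl_good_of_mem_cyclicBlock S hf D₃ D₁ D₂ hil.symm hij hjl.symm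
        h₃S h₃l h₃i h₁S h₁i h₁j h₂j hT
      exact ⟨h0, h1, h2, X, mem_union_right _ hX, h3⟩
  have hinj : Set.InjOn (fun T => S \ T) (E : Set (Finset α)) := by
    intro T₁ hT₁ T₂ hT₂ h
    have e₁ := Finset.sdiff_sdiff_eq_self (hmem T₁ hT₁).1
    have e₂ := Finset.sdiff_sdiff_eq_self (hmem T₂ hT₂).1
    simp only at h
    rw [← e₁, ← e₂, h]
  have himg : E.image (fun T => S \ T) ⊆
      {U ∈ S.powerset | f U = top ∧ f (S \ U) = bot ∧ ∃ X ∈ D₁ ∪ D₂ ∪ D₃, X ⊆ U} := by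
    intro U hU
    obtain ⟨T, hT, rfl⟩ := mem_image.mp hU
    obtain ⟨-, h1, h2, hX⟩ := hmem T hT
    rw [mem_filter, mem_powerset]
    exact ⟨sdiff_subset, h1, h2, hX⟩
  calc #D₁ + #D₂ + #D₃ ≤ #E := hMS3
    _ = #(E.image fun T => S \ T) := (card_image_of_injOn hinj).symm
    _ ≤ _ := card_le_card himg

end OrientedAntipodalHall

end Summit.CriticalPhenomena.PercolationContinuityZ3.Theorems
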